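import Summits.QuantumFields.YangMills.Theorems.FlatTubeReductionOrthoDensityProduct
import Summits.QuantumFields.YangMills.Theorems.FlatTubeReductionOrthoDensityFlatDeriv
import Summits.QuantumFields.YangMills.Theorems.LuscherReductionTwistedTraceScalingBOSupportGeometry
import Mathlib.MeasureTheory.Function.Jacobian
import HarnessLib

/-!
# ★★★ (E′)-lite: THE TRANSVERSE MEASURE `π = orthoTransverse L` OF THE ORTHOGRAPHIC TUBE IS TWO-SIDEDLY COMPARABLE WITH LEBESGUE MEASURE OF THE BALANCED SUBSPACE NEAR THE VACUUM —
# `c·balLebesgue L A ≤ π(A) ≤ C·balLebesgue L A` for measurable `A ⊆ capBalancedSet L ∩ ball 0 r₀`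
# (shared infrastructure of the rate twin «ratepack-v5» (Gaussian profile numbers of the hN/W package at radius `r_B`) and of lane A's (C1); route `FlatTubeReduction`, crux K1 `NearFlatRatioLaw`
# stmt-QuantumFields-24720; seat `ym-line-ftr-p1` g16; R2b1 RECORD rung — no summit statement is proved here)

WHY (memo `Cruxes/NearFlatRatioLaw/Lines/ratepack-v5-nearpair-g16.md` §5; NOTES `## PKG-R`).  The «profile numbers» of the stiff Gaussian profile at radius `r_B = β^{-1/2}log β` (mass
fractions, moments and tails RELATIVE to the `β^{-1/2}`-core) are constants for Lebesgue measure by scaling; to transfer them to the abstract transverse measure `π` (a marginal of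
product Haar measure along lane A's orthographic tube chart) one needs exactly this two-sided comparison near `0`.  No Jacobian determinant is computed: the flat chart map
`G = orthoFlat L` is strictly differentiable at `0` with injective derivative (`…FlatDeriv`, `…FlatMap`), so Mathlib's `addHaar_image_le_mul_of_det_lt` / `mul_le_addHaar_image_of_lt_det`
give `vol(G(S)) ≍ vol(S)` on a small ball; the rest is the product formula `σ³(window)·π(A) = σ^{⊗E}(tube set)`, the identification of the tube set with the gnomonic image of
`G(S(r₀,A))`, the product gnomonic chart law, and `vol(S(r₀,A)) = vol(ball)·balLebesgue L A` (`…Product`).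
* `abs_orthoFlat_le_two`, `orthoFlat_image_subset_box`;
* ★★★ `orthoTransverse_two_sided` (sup-ball radius), ★★ `orthoTransverse_two_sided_linkEmbed` (Euclidean radius `‖linkEmbed L v‖ < r₀`);
* `balLebesgue_compl_balancedSet`, `mem_capBalancedSet_of_norm_lt`, ★★★ `orthoTransverse_lintegral_two_sided` (integral form: `c∫f dν ≤ ∫f dπ ≤ C∫f dν` for measurable `f ≥ 0`
  vanishing off a small sup-ball).
HONEST FRAMING: a chart-density theorem (Mathlib calculus + measure theory + the tree's gnomonic Haar formula); the Gaussian profile numbers and the radius-`r_B` package are the NEXT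
files; femto rung R2b1 (RECORD label); not infinite volume, not a gap, not Clay.  No defs, no named facts, no `sorry`.
-/

set_option autoImplicit false

noncomputable section

open MeasureTheory Filter Topology Real
open scoped BigOperators Matrix NNReal ENNReal
open Literature.MathematicalPhysics.QuantumFieldTheory
open Literature.MathematicalPhysics.QuantumLattice
open Literature.MathematicalPhysics.QuantumFieldTheory.Balaban1983to89.T4CubeChartGnomonic (gnoPoint)

namespace Summit.QuantumFields.YangMills.Theorems.FemtoTransferGap.TwoLattice.ConstTube

open Summit.QuantumFields.YangMills.Theorems.FemtoTransferGap
open Summit.QuantumFields.YangMills.Theorems.FemtoTransferGap.TwoLattice.SlowChart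
open Summit.QuantumFields.YangMills.Theorems.FemtoTransferGap.TwoLattice.GnChart

variable (L : ℕ) [NeZero L]

/-! ## §1 The flat image stays in the sup-box `{|z_e a| ≤ 2}` -/

/-- In the smallness regime `|orthoFlat L y e a| ≤ 2`. [folklore] -/
theorem abs_orthoFlat_le_two {y : Edge 3 L → Fin 3 → ℝ} (hy : ‖y‖ ≤ 1 / (4 * Fintype.card (Site 3 L))) (e : Edge 3 L) (a : Fin 3) : |orthoFlat L y e a| ≤ 2 := by
  obtain ⟨h1, -, h3⟩ := orthoFlat_regime L hy e
  have hN1 : (1 : ℝ) ≤ Fintype.card (Site 3 L) := by exact_mod_cast Fintype.card_pos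
  have hy0 : 0 ≤ ‖y‖ := norm_nonneg _
  set v : Fin 3 → ℝ := balFill L y e
  set b : Fin 3 → ℝ := y (0, e.2)
  set p₀ : ℝ := Real.sqrt (1 - ∑ c, v c ^ 2)
  have hva : ∀ c, |v c| ≤ 1 / 4 := fun c => (abs_balFill_le L y e c).trans (by
    calc (Fintype.card (Site 3 L) : ℝ) * ‖y‖ ≤ Fintype.card (Site 3 L) * (1 / (4 * Fintype.card (Site 3 L))) := mul_le_mul_of_nonneg_left hy (by positivity)
      _ = 1 / 4 := by field_simp)
  have hba : ∀ c, |b c| ≤ 1 / 4 := fun c => (abs_apply_le_norm L y _ c).trans (hy.trans (one_div_le_one_div_of_le (by norm_num) (by linarith)))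
  have hvn : ‖v‖ ≤ 1 / 4 := (pi_norm_le_iff_of_nonneg (by norm_num)).2 fun c => by rw [Real.norm_eq_abs]; exact hva c
  have hbn : ‖b‖ ≤ 1 / 4 := (pi_norm_le_iff_of_nonneg (by norm_num)).2 fun c => by rw [Real.norm_eq_abs]; exact hba c
  have hp1 : p₀ ≤ 1 := Real.sqrt_le_one.mpr (by linarith [Finset.sum_nonneg fun c (_ : c ∈ Finset.univ) => sq_nonneg (v c)])
  have hp0 : 0 ≤ p₀ := Real.sqrt_nonneg _
  have hcross : |(v ⨯₃ b) a| ≤ 2 * ((1 / 4) * (1 / 4)) := by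
    calc |(v ⨯₃ b) a| = ‖(v ⨯₃ b) a‖ := (Real.norm_eq_abs _).symm
      _ ≤ ‖v ⨯₃ b‖ := norm_le_pi_norm _ a
      _ ≤ 2 * (‖v‖ * ‖b‖) := norm_cross_le_two v b
      _ ≤ 2 * ((1 / 4) * (1 / 4)) := by nlinarith [norm_nonneg v, norm_nonneg b]
  have hnum : |p₀ * b a + v a + (v ⨯₃ b) a| ≤ 1 := by
    have h := (abs_add_three (p₀ * b a) (v a) ((v ⨯₃ b) a)).trans (add_le_add (add_le_add (le_refl _) (hva a)) hcross)
    rw [abs_mul, abs_of_nonneg hp0] at h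
    nlinarith [hba a, abs_nonneg (b a)]
  have hden : (0 : ℝ) < p₀ - v ⬝ᵥ b := by linarith
  show |(p₀ * b a + v a + (v ⨯₃ b) a) / (p₀ - v ⬝ᵥ b)| ≤ 2
  rw [abs_div, abs_of_pos hden, div_le_iff₀ hden]
  linarith

/-- The flat image of the sup-ball of radius `1/(4N)` lies in the sup-box `{|z_e a| ≤ 2}`. [folklore] -/
theorem orthoFlat_image_subset_box {S : Set (Edge 3 L → Fin 3 → ℝ)} (hS : S ⊆ Metric.ball 0 (1 / (4 * Fintype.card (Site 3 L)))) :
    orthoFlat L '' S ⊆ {z | ∀ (e : Edge 3 L) (a : Fin 3), |z e a| ≤ 2} := by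
  rintro _ ⟨y, hy, rfl⟩ e a
  exact abs_orthoFlat_le_two L (mem_ball_zero_iff.1 (hS hy)).le e a

/-! ## §2 ★★★ (E′)-lite: the transverse measure is two-sidedly comparable with Lebesgue measure of the balanced subspace near `0` -/

/-- ★★★ **(E′)-lite — THE FLAT DENSITY OF THE TRANSVERSE MEASURE NEAR THE VACUUM.**  There are `r₀ > 0` and constants `0 < c`, `C < ∞` such that for every measurable
`A ⊆ capBalancedSet L` inside the sup-ball `ball 0 r₀`:  `c · balLebesgue L A ≤ orthoTransverse L A ≤ C · balLebesgue L A`.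
Assembly: `σ³(window)·π(A) = σ^{⊗E}(tube set)` (`…OrthoDensityProduct.configMeasure_slowWindow_mul_orthoTransverse`), tube set `=` gnomonic image of `orthoFlat L '' flatBox`
(`slowEmb_image_eq`), `σ^{⊗E}` of a gnomonic image `=` the product gnomonic law (`configMeasure_image_gnoPoint`), two-sidedly Lebesgue on the sup-box (`withDensity_piGnDensity_two_sided`),
`vol(orthoFlat L '' flatBox) ≍ vol(flatBox)` (Mathlib `addHaar_image_le_mul_of_det_lt` / `mul_le_addHaar_image_of_lt_det` with `…FlatDeriv.approximatesLinearOn_orthoFlat`,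
`…FlatMap.orthoFlatLin_det_ne_zero`), and `vol(flatBox) = vol(ball)·balLebesgue L A` (`volume_flatBox`). [cite: Luscher1983, §3] -/
theorem orthoTransverse_two_sided :
    ∃ r₀ : ℝ, 0 < r₀ ∧ ∃ c C : ℝ≥0∞, 0 < c ∧ C < ⊤ ∧ ∀ A : Set (Edge 3 L → Fin 3 → ℝ), MeasurableSet A → A ⊆ capBalancedSet L → A ⊆ Metric.ball 0 r₀ →
      c * balLebesgue L A ≤ orthoTransverse L A ∧ orthoTransverse L A ≤ C * balLebesgue L A := by
  have hN : (0 : ℝ) < Fintype.card (Site 3 L) := by exact_mod_cast Fintype.card_pos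
  -- (1) the Jacobian constants
  have hdet : (orthoFlatLin L).det ≠ 0 := orthoFlatLin_det_ne_zero L
  set d : ℝ≥0 := Real.toNNReal |(orthoFlatLin L).det| with hd
  have hdpos : 0 < d := by rw [hd]; exact Real.toNNReal_pos.2 (abs_pos.2 hdet)
  have hdet_eq : ENNReal.ofReal |(orthoFlatLin L).det| = (d : ℝ≥0∞) := by rw [hd, ENNReal.ofReal]
  have hup : ENNReal.ofReal |(orthoFlatLin L).det| < ((d + 1 : ℝ≥0) : ℝ≥0∞) := by
    rw [hdet_eq]; exact_mod_cast lt_add_one d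
  have hlo : ((d / 2 : ℝ≥0) : ℝ≥0∞) < ENNReal.ofReal |(orthoFlatLin L).det| := by
    rw [hdet_eq]; exact_mod_cast NNReal.half_lt_self hdpos.ne'
  have h1 := addHaar_image_le_mul_of_det_lt (volume : Measure (Edge 3 L → Fin 3 → ℝ)) (orthoFlatLin L) hup
  have h2 := mul_le_addHaar_image_of_lt_det (volume : Measure (Edge 3 L → Fin 3 → ℝ)) (orthoFlatLin L) hlo
  obtain ⟨δ, ⟨hP, hQ⟩, hδ0⟩ := ((h1.and h2).and self_mem_nhdsWithin).exists
  obtain ⟨ρ, hρ0, hAL⟩ := approximatesLinearOn_orthoFlat L (show (0 : ℝ≥0) < δ from hδ0)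
  -- (2) the radius and the constants
  set r₀ : ℝ := min ρ (1 / (4 * Fintype.card (Site 3 L))) with hr₀
  have hr₀0 : 0 < r₀ := lt_min hρ0 (by positivity)
  have hr₀ρ : r₀ ≤ ρ := min_le_left _ _
  have hr₀N : r₀ ≤ 1 / (4 * Fintype.card (Site 3 L)) := min_le_right _ _
  set w : ℝ≥0∞ := configMeasure SU2 1 {u : GaugeConfig 3 1 SU2 | ∀ e₁ : Edge 3 1, 0 < scalarPart (u e₁) ∧ ‖vecPart (u e₁)‖ < r₀ * scalarPart (u e₁)} with hw
  have hw0 : w ≠ 0 := (configMeasure_slowWindow_pos hr₀0).ne'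
  have hwtop : w ≠ ⊤ := (prob_le_one.trans_lt ENNReal.one_lt_top).ne
  set vb : ℝ≥0∞ := volume (Metric.ball (0 : {e : Edge 3 L // e.1 = 0} → Fin 3 → ℝ) r₀) with hvb
  have hvb0 : vb ≠ 0 := (Metric.isOpen_ball.measure_pos volume ⟨0, Metric.mem_ball_self hr₀0⟩).ne'
  have hvbtop : vb ≠ ⊤ := measure_ball_lt_top.ne
  set dlo : ℝ≥0∞ := ENNReal.ofReal (((2 * π ^ 2)⁻¹ * ((1 + 3 * 2 ^ 2)⁻¹) ^ 2) ^ Fintype.card (Edge 3 L)) with hdlo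
  set dhi : ℝ≥0∞ := ENNReal.ofReal (((2 * π ^ 2)⁻¹) ^ Fintype.card (Edge 3 L)) with hdhi
  have hdlo0 : dlo ≠ 0 := by rw [hdlo]; exact (ENNReal.ofReal_pos.2 (by positivity)).ne'
  refine ⟨r₀, hr₀0, dlo * (d / 2 : ℝ≥0) * vb * w⁻¹, dhi * (d + 1 : ℝ≥0) * vb * w⁻¹, ?_, ?_, fun A hA hAc hAb => ?_⟩
  · refine ENNReal.mul_pos (mul_ne_zero (mul_ne_zero hdlo0 ?_) hvb0) (ENNReal.inv_ne_zero.2 hwtop) |>.ne' |> pos_iff_ne_zero.2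
    exact_mod_cast (half_pos hdpos).ne'
  · exact ENNReal.mul_lt_top (ENNReal.mul_lt_top (ENNReal.mul_lt_top ENNReal.ofReal_lt_top ENNReal.coe_lt_top) measure_ball_lt_top) (ENNReal.inv_lt_top.2 (pos_iff_ne_zero.2 hw0))
  -- (3) the sets
  have hAb' : A ⊆ Metric.ball 0 (1 / (4 * Fintype.card (Site 3 L))) := hAb.trans (Metric.ball_subset_ball hr₀N)
  set S : Set (Edge 3 L → Fin 3 → ℝ) := {y | (fun i : {e : Edge 3 L // e.1 = 0} => y i.1) ∈ Metric.ball (0 : {e : Edge 3 L // e.1 = 0} → Fin 3 → ℝ) r₀ ∧ balFill L y ∈ A} with hS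
  have hSρ : S ⊆ Metric.ball 0 ρ := flatBox_subset_ball L hρ0 hr₀ρ (hAb.trans (Metric.ball_subset_ball hr₀ρ))
  have hSN : S ⊆ Metric.ball 0 (1 / (4 * Fintype.card (Site 3 L))) := flatBox_subset_ball L (by positivity) hr₀N hAb'
  have hvolS : volume S = vb * balLebesgue L A := volume_flatBox L r₀ hA
  -- (4) the Jacobian sandwich for `W = orthoFlat '' S`
  have hALS : ApproximatesLinearOn (orthoFlat L) (orthoFlatLin L) S δ := hAL.mono_set hSρ
  have hWup : volume (orthoFlat L '' S) ≤ ((d + 1 : ℝ≥0) : ℝ≥0∞) * volume S := hP S _ hALS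
  have hWlo : ((d / 2 : ℝ≥0) : ℝ≥0∞) * volume S ≤ volume (orthoFlat L '' S) := hQ S _ hALS
  -- (5) the chart law sandwich
  have hWbox := orthoFlat_image_subset_box L hSN
  obtain ⟨hDlo, hDhi⟩ := withDensity_piGnDensity_two_sided L hWbox
  -- (6) the product formula and the chart law
  have hT := slowEmb_image_eq L hr₀0 hr₀N hAc hAb'
  have hTm := measurableSet_slowEmb_image L r₀ hA
  have hprod := configMeasure_slowWindow_mul_orthoTransverse L r₀ hA
  rw [hT] at hTm hprod
  rw [configMeasure_image_gnoPoint L hTm] at hprod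
  -- (7) assemble: `w · π(A) = μ(W)`
  have hπ : orthoTransverse L A = w⁻¹ * ((volume : Measure (Edge 3 L → Fin 3 → ℝ)).withDensity (piGnDensity (Edge 3 L))) (orthoFlat L '' S) := by
    rw [← hprod, ← mul_assoc, ENNReal.inv_mul_cancel hw0 hwtop, one_mul]
  rw [hπ]
  constructor
  · calc dlo * ((d / 2 : ℝ≥0) : ℝ≥0∞) * vb * w⁻¹ * balLebesgue L A = w⁻¹ * (dlo * (((d / 2 : ℝ≥0) : ℝ≥0∞) * (vb * balLebesgue L A))) := by ring
      _ = w⁻¹ * (dlo * (((d / 2 : ℝ≥0) : ℝ≥0∞) * volume S)) := by rw [hvolS]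
      _ ≤ w⁻¹ * (dlo * volume (orthoFlat L '' S)) := by gcongr
      _ ≤ w⁻¹ * ((volume : Measure (Edge 3 L → Fin 3 → ℝ)).withDensity (piGnDensity (Edge 3 L))) (orthoFlat L '' S) := by gcongr
  · calc w⁻¹ * ((volume : Measure (Edge 3 L → Fin 3 → ℝ)).withDensity (piGnDensity (Edge 3 L))) (orthoFlat L '' S)
        ≤ w⁻¹ * (dhi * volume (orthoFlat L '' S)) := by gcongr
      _ ≤ w⁻¹ * (dhi * ((((d + 1 : ℝ≥0)) : ℝ≥0∞) * volume S)) := by gcongr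
      _ = w⁻¹ * (dhi * ((((d + 1 : ℝ≥0)) : ℝ≥0∞) * (vb * balLebesgue L A))) := by rw [hvolS]
      _ = dhi * ((d + 1 : ℝ≥0) : ℝ≥0∞) * vb * w⁻¹ * balLebesgue L A := by ring

/-- ★★ **(E′)-lite in the Euclidean radius**: the same with the hypothesis `A ⊆ {v | ‖linkEmbed L v‖ < r₀}` (the Euclidean norm of the link space dominates the sup norm). [folklore] -/
theorem orthoTransverse_two_sided_linkEmbed :
    ∃ r₀ : ℝ, 0 < r₀ ∧ ∃ c C : ℝ≥0∞, 0 < c ∧ C < ⊤ ∧ ∀ A : Set (Edge 3 L → Fin 3 → ℝ), MeasurableSet A → A ⊆ capBalancedSet L → A ⊆ {v | ‖linkEmbed L v‖ < r₀} →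
      c * balLebesgue L A ≤ orthoTransverse L A ∧ orthoTransverse L A ≤ C * balLebesgue L A := by
  obtain ⟨r₀, hr₀, c, C, hc, hC, h⟩ := orthoTransverse_two_sided L
  refine ⟨r₀, hr₀, c, C, hc, hC, fun A hA hAc hAb => h A hA hAc fun v hv => ?_⟩
  rw [mem_ball_zero_iff, pi_norm_lt_iff hr₀]
  intro e
  exact (norm_apply_le_norm_linkEmbed v e).trans_lt (hAb hv)

/-! ## §3 Integral form: `c·∫ f dν ≤ ∫ f dπ ≤ C·∫ f dν` for `f ≥ 0` supported in a small sup-ball -/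

/-- `balLebesgue L` is carried by the balanced subspace. [folklore] -/
theorem balLebesgue_compl_balancedSet : balLebesgue L (balancedSet L)ᶜ = 0 := by
  rw [balLebesgue, Measure.map_apply (balExt L).continuous.measurable (measurableSet_balancedSet L).compl]
  have h : (balExt L) ⁻¹' (balancedSet L)ᶜ = ∅ := by
    ext w; simp only [Set.mem_preimage, Set.mem_compl_iff, Set.mem_empty_iff_false, iff_false, not_not]; exact balExt_mem_balancedSet L w
  rw [h, measure_empty]

/-- A balanced vector of sup norm `< 1/4` is capped. [folklore] -/
theorem mem_capBalancedSet_of_norm_lt {v : Edge 3 L → Fin 3 → ℝ} (hv : v ∈ balancedSet L) (hn : ‖v‖ < 1 / 4) : v ∈ capBalancedSet L := by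
  refine ⟨hv, fun e => ?_⟩
  have h : ∀ a, |v e a| ≤ 1 / 4 := fun a => (abs_apply_le_norm L v e a).trans hn.le
  exact (sum_sq_le_three_mul_sq h).trans (by norm_num)

/-- ★★★ **(E′)-lite, INTEGRAL FORM**: there are `r₀ > 0`, `0 < c`, `C < ∞` with `c·∫⁻ f dν ≤ ∫⁻ f dπ ≤ C·∫⁻ f dν` (`ν = balLebesgue L`, `π = orthoTransverse L`) for every measurable
`f : (Edge → ℝ³) → [0,∞]` vanishing off the sup-ball `ball 0 r₀`. [cite: Luscher1983, §3] -/
theorem orthoTransverse_lintegral_two_sided :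
    ∃ r₀ : ℝ, 0 < r₀ ∧ ∃ c C : ℝ≥0∞, 0 < c ∧ C < ⊤ ∧ ∀ f : (Edge 3 L → Fin 3 → ℝ) → ℝ≥0∞, Measurable f → (∀ v, f v ≠ 0 → ‖v‖ < r₀) →
      c * ∫⁻ v, f v ∂balLebesgue L ≤ ∫⁻ v, f v ∂orthoTransverse L ∧ ∫⁻ v, f v ∂orthoTransverse L ≤ C * ∫⁻ v, f v ∂balLebesgue L := by
  obtain ⟨r₁, hr₁, c, C, hc, hC, h⟩ := orthoTransverse_two_sided L
  set r₀ : ℝ := min r₁ (1 / 4) with hr₀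
  have hr₀0 : 0 < r₀ := lt_min hr₁ (by norm_num)
  have hr₀1 : r₀ ≤ r₁ := min_le_left _ _
  have hr₀4 : r₀ ≤ 1 / 4 := min_le_right _ _
  set S : Set (Edge 3 L → Fin 3 → ℝ) := capBalancedSet L ∩ Metric.ball 0 r₀ with hS
  have hSm : MeasurableSet S := (measurableSet_capBalancedSet L).inter Metric.isOpen_ball.measurableSet
  -- the two measure inequalities on `S`
  have hup : (orthoTransverse L).restrict S ≤ C • (balLebesgue L).restrict S := by
    refine Measure.le_iff.2 fun A hA => ?_
    rw [Measure.restrict_apply hA, Measure.smul_apply, Measure.restrict_apply hA, smul_eq_mul]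
    exact (h (A ∩ S) (hA.inter hSm) (Set.inter_subset_right.trans Set.inter_subset_left)
      (Set.inter_subset_right.trans (Set.inter_subset_right.trans (Metric.ball_subset_ball hr₀1)))).2
  have hlo : c • (balLebesgue L).restrict S ≤ (orthoTransverse L).restrict S := by
    refine Measure.le_iff.2 fun A hA => ?_
    rw [Measure.restrict_apply hA, Measure.smul_apply, Measure.restrict_apply hA, smul_eq_mul]
    exact (h (A ∩ S) (hA.inter hSm) (Set.inter_subset_right.trans Set.inter_subset_left)
      (Set.inter_subset_right.trans (Set.inter_subset_right.trans (Metric.ball_subset_ball hr₀1)))).1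
  refine ⟨r₀, hr₀0, c, C, hc, hC, fun f hf hf0 => ?_⟩
  -- `∫ f dπ = ∫_S f dπ` (π is carried by the capped balanced set, `f` by the ball)
  have hπS : ∫⁻ v, f v ∂orthoTransverse L = ∫⁻ v in S, f v ∂orthoTransverse L := by
    have hae : ∀ᵐ v ∂orthoTransverse L, v ∈ capBalancedSet L := by
      rw [ae_iff]; exact orthoTransverse_compl_capBalancedSet L
    rw [hS, ← Measure.restrict_restrict (measurableSet_capBalancedSet L), Measure.restrict_eq_self_of_ae_mem (μ := (orthoTransverse L).restrict (Metric.ball 0 r₀)) ?_]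
    · exact (setLIntegral_eq_of_support_subset fun v hv => mem_ball_zero_iff.2 (hf0 v hv)).symm
    · exact ae_restrict_of_ae hae
  -- `∫ f dν = ∫_S f dν` (ν is carried by the balanced set; balanced + small ⇒ capped)
  have hνS : ∫⁻ v, f v ∂balLebesgue L = ∫⁻ v in S, f v ∂balLebesgue L := by
    have hae : ∀ᵐ v ∂balLebesgue L, v ∈ balancedSet L := by
      rw [ae_iff]; exact balLebesgue_compl_balancedSet L
    have h1 : ∫⁻ v, f v ∂balLebesgue L = ∫⁻ v in balancedSet L, f v ∂balLebesgue L := by rw [Measure.restrict_eq_self_of_ae_mem hae]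
    rw [h1]
    have h2 : ∫⁻ v in balancedSet L, f v ∂balLebesgue L = ∫⁻ v in balancedSet L, S.indicator f v ∂balLebesgue L := by
      refine setLIntegral_congr_fun (measurableSet_balancedSet L) fun v hv => ?_
      by_cases hfv : f v = 0
      · rw [hfv]; by_cases hvS : v ∈ S
        · rw [Set.indicator_of_mem hvS, hfv]
        · rw [Set.indicator_of_notMem hvS]
      · have hvS : v ∈ S := ⟨mem_capBalancedSet_of_norm_lt L hv ((hf0 v hfv).trans_le hr₀4), mem_ball_zero_iff.2 (hf0 v hfv)⟩
        rw [Set.indicator_of_mem hvS]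
    rw [h2, lintegral_indicator hSm, Measure.restrict_restrict hSm, Set.inter_eq_left.2 (Set.inter_subset_left.trans fun v hv => hv.1), ]
  rw [hπS, hνS]
  constructor
  · calc c * ∫⁻ v in S, f v ∂balLebesgue L = ∫⁻ v, f v ∂(c • (balLebesgue L).restrict S) := by rw [lintegral_smul_measure, smul_eq_mul]
      _ ≤ ∫⁻ v, f v ∂(orthoTransverse L).restrict S := lintegral_mono' hlo le_rfl
  · calc ∫⁻ v in S, f v ∂orthoTransverse L ≤ ∫⁻ v, f v ∂(C • (balLebesgue L).restrict S) := lintegral_mono' hup le_rfl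
      _ = C * ∫⁻ v in S, f v ∂balLebesgue L := by rw [lintegral_smul_measure, smul_eq_mul]

end Summit.QuantumFields.YangMills.Theorems.FemtoTransferGap.TwoLattice.ConstTube

end
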